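import Summits.BirchSwinnertonDyer.BirchSwinnertonDyer.Theses.SignedLowerHalves
import Summits.BirchSwinnertonDyer.Rank1Residual.Supersingular.KobayashiMainConjecture
import Summits.BirchSwinnertonDyer.Rank1Residual.TwoVariableGreenbergMainConjectureAnyRoot
import Literature.NumberTheory.EllipticCurves.Rank1Residual.Typed.X7
import Literature.NumberTheory.EllipticCurves.BurungaleCastellaSkinner2025.BDPMainConjecture
import HarnessLib

/-!
# Line `kudla-congruence` — crux `KobayashiLowerHalfLargeImage` (route SignedLowerHalves, item
# stmt-BirchSwinnertonDyer-19001, rank 3): an EISENSTEIN SIDE WITHOUT JACQUET–LANGLANDS — endoscopic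
# (Kudla-lift) congruences on the Picard modular surface `U(2,1)_{K/ℚ}` supply the anticyclotomic
# BDP/Greenberg LOWER bound for EVERY X7 curve over every all-split `K`; the crux then follows through the
# anticyclotomic-to-cyclotomic squeeze of the registered line `ac2cyc-squeeze`.

HONEST FRAMING (D-0152): this line feeds the CLASS route K3 = `SignedLowerHalves` (leaf
`Rank1Residual.Supersingular.SignedSupersingular`); nothing here proves BSD; every `stub_*` is `sorry`;
the compositions only show that the stubs, if proved, give the crux BY NAME. The NEW content of this line
is ONE stub, `stub_bdpLowerHalf_kudla` (K1, the engine, NOT IN PRINT — a programme); `stub_acLine_of_bdp`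
(K2) is printed-modulo-bookkeeping; A1, A3, A4, A5, A6 are VERBATIM the stubs of `Lines/ac2cyc_squeeze.lean`
(shared statements — this line REPLACES that line's stub A2 `stub_acLineEquality`, whose why-it-might-fail
was "Kolyvagin's conjecture for every Heegner `K` is open off Zhang's locus — contains road K's atom", by
K1 + K2, and inherits its open stub A3). The lever and the squeeze lemma are copied verbatim from
`Lines/ac2cyc_squeeze.lean` (PROVED there and here; line modules are not importable on the farm).

LEVER (new on this crux). Every Eisenstein side proposed so far for X7 needs the newform `f = f_E` on a
DEFINITE group: Wan's `U(3,1)` Klingen family has Levi `U(2,0) × Res GL₁` (so `f ↦ f_B` by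
Jacquet–Langlands, i.e. a prime `q ∥ N` or a supercuspidal prime non-split in `K` — impossible when every
bad prime of `E` is additive principal series: dossier L3-4 / FW locus), Skinner–Urban's `U(2,2)` needs
Borel-ordinarity and a definite `U(β)` for the Fourier coefficient, `hilbert-door` moves to a real
quadratic `F` to find an unramified definite quaternion algebra. The UNITARY GROUP IN THREE VARIABLES has
no such parity obstruction and needs no transfer of `f` at all: the quasi-split `U(2,1)` exists for every
`K`, and `f` (weight 2, ANY level, viewed on `U(1,1)`) enters through the unitary KUDLA LIFT
`θ(f, χ)` — the endoscopic transfer from `U(1,1) × U(1)` [Kudla 1979/81; Gelbart–Rogawski–Soudry 1997;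
Murase–Sugano 2007]. Its local theta lifts are non-zero at EVERY finite place whatever `π_{f,q}` is
(conservation relation for the pair `(U(W₂), U(V₃))`: first occurrence `≤ 3` in both Witt towers for
infinite-dimensional `π_q`), and globally `θ(f,χ) ≠ 0` because `L(s, BC_K(π_f) ⊗ χ')` does not vanish at
the edge `s = 1` (Jacquet–Shalika) — no `L`-value or sign hypothesis. DICTIONARY of the Eisenstein-ideal
method (Skinner–Urban / Hsieh 2014 on the SAME surface / Wan 2020), entry by entry:
* family: `χ` runs over anticyclotomic Hecke characters of `K` of `p`-power conductor and varying
  infinity type; at `p = v v̄` SPLIT, `U(2,1)(ℚ_p) = GL₃(ℚ_p)` and `θ(f,χ)_p` has parameter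
  `{α·μ, β·μ, χ_v}`; it is `P_{2,1}`-ORDINARY (semi-ordinary): the `U_P`-eigenvalue of the `f`-block is
  `αβ·μ² = p·ε·μ²`, a unit after weight normalisation BECAUSE `det ρ_f = ε` — the individual slopes
  `½, ½` of `a_p = 0` never enter (slope-free in `f`; semi-ordinary Hida theory on unitary Shimura
  varieties at split `p`: Wan 2020 §3 for `U(3,1)`, Hida 2004 for the Igusa tower of `U(2,1)`);
* Fourier–Jacobi primitivity mod `p`: by Murase–Sugano's Main Theorem I the PRIMITIVE Fourier–Jacobi
  components of `θ(f,χ)` are `c · I(Θ) · J(f,χ)` with `c ≠ 0` explicit, `I(Θ)` the period of a primitive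
  theta function on the Heisenberg group (a CM period) and `J(f,χ)` a linear combination of CM VALUES OF
  `f` ON THE MODULAR CURVE twisted by `χ` — exactly the quantities whose non-vanishing mod `p` along the
  anticyclotomic tower is Hida's/Hsieh's theorem (`μ(𝓛_p^BDP) = 0`, in the tree as the named fact
  `BurungaleCastellaSkinner2025.prop422_exists_isBDPLFunction_mu_eq_zero`, sourced Hsieh 2014 Thm. B:
  all-split `K`, `p` split, ANY `N`, `ρ̄` irreducible). In Wan's `U(3,1)` argument the same slot is filled
  by CM values of `f_B` on the definite quaternion set — THIS is where Jacquet–Langlands is avoided;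
* congruence module: Petersson norm of the `P`-stabilised `θ(f,χ)` (Rallis inner product formula for
  the unitary Kudla lift, Murase–Sugano 2006) `≐ L(1, BC_K(π_f) ⊗ χ̃) ·` (CM periods), whose
  `p`-adic interpolation in `χ` is (a shift of) the BDP / anticyclotomic Greenberg function `G⁻`;
  endoscopic ("Kudla") ideal `⊇ (G⁻)` up to the `f`-congruence number (constant in `χ`, absorbed because
  `μ(G⁻) = 0`);
* lattice: stable forms on `U(2,1)` have IRREDUCIBLE 3-dimensional Galois representations
  (Blasius–Rogawski); `P_{2,1}`-ordinarity at `v` gives a `G_{K_v}`-stable plane lifting `ρ_f ⊗ μ` with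
  quotient `χ`, and the conjugate-dual flag at `v̄`; the Ribet/Urban lattice produces classes in
  `H¹(K, ρ_f ⊗ μχ⁻¹ ⊗ Λ_ac^∨)` UNRAMIFIED outside `p`, RELAXED at `v`, STRICT at `v̄` — Greenberg's
  `(rel_v, str_v̄)` = BDP Selmer condition (`AcSelmer.XAc … vbar ∅`), for all `χ` at once:
  `ch_Λ(X_ac^{rel,str}) ⊆ (𝓛^BDP)` = `stub_bdpLowerHalf_kudla`.
WHY ONE VARIABLE (structural, recorded): both pieces of an elliptic endoscopic parameter
`(ρ_f ⊗ μ) ⊕ χ` are conjugate-self-dual, so the Selmer group of a congruence is that of the RATIO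
`ρ_f ⊗ μχ⁻¹` with `μχ⁻¹` anticyclotomic: a compact-at-infinity or rank-one unitary host never sees the
cyclotomic variable (that needs a non-elliptic = Eisenstein parameter, i.e. `U(2,2)`/`U(3,1)`). Hence
this line reaches the cyclotomic crux only through the two-variable squeeze (A3–A5 below), exactly as
`ac2cyc-squeeze`; what it removes is that line's dependence on Kolyvagin's conjecture off Zhang's locus.

DEAD LINES (census, DOSSIER-19001 §6 + K2G7 addendum): «BSTW lower divisibility unpublished» — not
used (no Greenberg–Vatsal/BSTW Eisenstein congruence for `E[p]`; the congruences here are between CUSP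
forms on `U(2,1)` and are governed by `L`-values, not by `E[p]` being reducible — it is irreducible,
`Surj`); x6 `EisensteinHalfFiveLe` history — no quantitative Eisenstein-half statement at `p = 3`
(`stub_three` verbatim); FW 7.32 × road K, level-lowering/raising transport, CM transport, `A-lev-13`,
Wan 1607.07729 (withdrawn) — none used; `U(3,1)`/`U(2,2)`/definite-`U(2)` hosts — replaced, see LEVER;
"signed Klingen family on `U(2,2)`" — dead (signed ≠ congruence-stable local condition), not used:
the local condition here is a GALOIS FLAG at split `p` (semi-ordinary), which is congruence-stable.
-/

noncomputable section

open scoped Classical MatrixGroups ModularForm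

open PowerSeries NumberField IsDedekindDomain Field CongruenceSubgroup WeierstrassCurve
  Literature.NumberTheory.GaloisRepresentations Literature.NumberTheory.EllipticCurves
  Literature.NumberTheory.EllipticCurves.ModularForms Literature.NumberTheory.QuadraticFields
  Literature.NumberTheory.EllipticCurves.Rank1Residual
  Literature.NumberTheory.EllipticCurves.Rank1Residual.Typed
  Literature.NumberTheory.EllipticCurves.Castella2018
  Literature.NumberTheory.EllipticCurves.IwasawaAlgebra₂ Literature.NumberTheory.EllipticCurves.UnrSeries₂
  Literature.NumberTheory.EllipticCurves.GreenbergVatsal2000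
  Literature.NumberTheory.EllipticCurves.BurungaleCastellaSkinner2025
  Literature.NumberTheory.EllipticCurves.YanZhu2026
  Summit.BirchSwinnertonDyer.Rank1Residual.Supersingular
  Summit.BirchSwinnertonDyer.Rank1Residual.TwoVariableIMC

set_option linter.dupNamespace false

namespace Summit.BirchSwinnertonDyer.BirchSwinnertonDyer.Cruxes.KobayashiLowerHalfLargeImage

namespace KudlaCongruence

/-! ## The lever of the squeeze (PROVED; verbatim `Ac2CycSqueeze.span_eq_span_of_dvd_of_constantCoeff_dvd`) -/

/-- **Constant-term rigidity** over a domain: `a ∣ g`, `g(0) ∣ a(0)`, `g(0) ≠ 0` ⟹ `(a) = (g)`.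
Copied verbatim from `Lines/ac2cyc_squeeze.lean` (PROVED there). [cite: Greenberg1999LNM, Thm. 4.1 and §5 pp. 132–133] -/
theorem span_eq_span_of_dvd_of_constantCoeff_dvd {R : Type*} [CommRing R] [IsDomain R]
    {a g : PowerSeries R} (hag : a ∣ g)
    (h0 : PowerSeries.constantCoeff g ∣ PowerSeries.constantCoeff a)
    (hg0 : PowerSeries.constantCoeff g ≠ 0) :
    Ideal.span {a} = Ideal.span {g} := by
  obtain ⟨h, rfl⟩ := hag
  have ha0 : PowerSeries.constantCoeff a ≠ 0 := by
    intro ha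
    apply hg0
    rw [map_mul, ha, zero_mul]
  obtain ⟨k, hk⟩ := h0
  rw [map_mul] at hk
  have hunit : IsUnit (PowerSeries.constantCoeff h) := by
    have h1 : PowerSeries.constantCoeff a * (PowerSeries.constantCoeff h * k) =
        PowerSeries.constantCoeff a * 1 := by
      rw [mul_one, ← mul_assoc]; exact hk.symm
    exact IsUnit.of_mul_eq_one _ (mul_left_cancel₀ ha0 h1)
  have hU : IsUnit h := (PowerSeries.isUnit_iff_constantCoeff (φ := h)).mpr hunit
  exact (Ideal.span_singleton_mul_right_unit hU a).symm

/-! ## The squeeze (PROVED; verbatim `Ac2CycSqueeze.charIdeal_map_eq_span_of_katoSide_of_acLine`) -/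

/-- **The squeeze.** If `ch(X_Gr)` is principal, the Kato side `(G) ⊆ (A)` and the anticyclotomic-line
equality `(A)|_{T₁=0} = (G⁻)`, `G⁻ ≠ 0`, force `(A) = (G)` along every compatible `J`.
Copied verbatim from `Lines/ac2cyc_squeeze.lean` (PROVED there). [cite: Greenberg1999LNM, Thm. 4.1 and §5 pp. 132–133] -/
theorem charIdeal_map_eq_span_of_katoSide_of_acLine {p : ℕ} [Fact p.Prime]
    (W : WeierstrassCurve ℚ) [W.IsElliptic] [W.IsGloballyMinimal] (K : Type) [Field K] [NumberField K]
    (vbar : HeightOneSpectrum (𝓞 K)) (κ₁ κ₂ : ZpExtension K p) (γ₁ γ₂ : absoluteGaloisGroup K)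
    [Fact (ZpExtension.IsTopGeneratorPair κ₁ κ₂ γ₁ γ₂)]
    (G : PowerSeries (PowerSeries (PadicComplexInt p)))
    (hprinc : (WeierstrassCurve.XGr₂.charIdeal (W.baseChange K) p κ₁ κ₂ vbar γ₁ γ₂).IsPrincipal)
    (hKato : (Module.IsTorsion (IwasawaAlgebra₂ p) ((W.baseChange K).XGr₂ p κ₁ κ₂ vbar γ₁ γ₂) ∧
          ∀ J : ℤ_[p] →+* PadicComplexInt p,
            (∀ x : ℤ_[p], ((J x : PadicComplexInt p) : ℂ_[p]) = ((x : ℚ_[p]) : ℂ_[p])) →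
            Ideal.span {G} ≤
              (WeierstrassCurve.XGr₂.charIdeal (W.baseChange K) p κ₁ κ₂ vbar γ₁ γ₂).map (toUnr₂ p J)))
    (hAc : (minus G ≠ 0 ∧
          ∀ J : ℤ_[p] →+* PadicComplexInt p,
            (∀ x : ℤ_[p], ((J x : PadicComplexInt p) : ℂ_[p]) = ((x : ℚ_[p]) : ℂ_[p])) →
            ((WeierstrassCurve.XGr₂.charIdeal (W.baseChange K) p κ₁ κ₂ vbar γ₁ γ₂).map (toUnr₂ p J)).map
                (PowerSeries.constantCoeff :
                  PowerSeries (PowerSeries (PadicComplexInt p)) →+* PowerSeries (PadicComplexInt p)) =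
              Ideal.span {minus G})) :
    ∀ J : ℤ_[p] →+* PadicComplexInt p,
      (∀ x : ℤ_[p], ((J x : PadicComplexInt p) : ℂ_[p]) = ((x : ℚ_[p]) : ℂ_[p])) →
      (WeierstrassCurve.XGr₂.charIdeal (W.baseChange K) p κ₁ κ₂ vbar γ₁ γ₂).map (toUnr₂ p J) =
        Ideal.span {G} := by
  intro J hJ
  obtain ⟨A, hA⟩ := hprinc
  set A' : PowerSeries (PowerSeries (PadicComplexInt p)) := toUnr₂ p J A with hA'
  have hmap : (WeierstrassCurve.XGr₂.charIdeal (W.baseChange K) p κ₁ κ₂ vbar γ₁ γ₂).map (toUnr₂ p J) =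
      Ideal.span {A'} := by
    rw [hA, Ideal.submodule_span_eq, Ideal.map_span, Set.image_singleton]
  rw [hmap]
  have hdvd : A' ∣ G := by
    have h := hKato.2 J hJ
    rw [hmap] at h
    exact Ideal.span_singleton_le_span_singleton.mp h
  have hline : PowerSeries.constantCoeff G ∣ PowerSeries.constantCoeff A' := by
    have h := hAc.2 J hJ
    rw [hmap, Ideal.map_span, Set.image_singleton] at h
    have hmem : PowerSeries.constantCoeff A' ∈ Ideal.span {minus G} := h ▸ Ideal.subset_span rfl
    exact Ideal.mem_span_singleton.mp hmem
  exact span_eq_span_of_dvd_of_constantCoeff_dvd hdvd hline hAc.1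

/-! ## Stubs

Hypothesis blocks (verbatim the frame of `Lines/ac2cyc_squeeze.lean`): X7 data `5 ≤ p → ClassX7 W p →
¬ W.HasCM → W.frobeniusTrace p = 0 → Surj W p`; DATA = Heegner `p`-split data; FRAME = the Greenberg
value frame of `TwoVariableIMC.GreenbergTwoVariableMainConjectureAnyRootAt`. The ONE-VARIABLE BDP
vocabulary of K1 is the tree's: `IsBDPLFunction ι v κ γ f ΩK Ωp L` (Castella 2018 Thm. 3.1 normalisation,
`L ∈ Λ^ur = UnrSeries p`) and `AcSelmer.XAc (W.baseChange K) p κ vbar ∅ γ` = the Pontryagin dual of the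
anticyclotomic Selmer group STRICT at `v̄`, RELAXED at `v` (`𝔭 = v̄`, `Σ = ∅`; CGLS 2022 `𝔛_E`), exactly
as in `BurungaleCastellaSkinner2025.thm124b_exists_isBDPLFunction_isTorsion_charIdeal_eq` (whose
conclusion is the EQUALITY at ordinary `p`; `thm421b_…_mem_charIdeal` is the Heegner-side containment
`(L) ⊆ ch`). -/

/-- **K1 · THE ENGINE — the Kudla-lift (endoscopic `U(2,1)`) lower half of the anticyclotomic BDP main
conjecture on X7** (`stub_bdpLowerHalf_kudla`): for an X7 pair `(W,p)` (`p ≥ 5`, `a_p = 0`, `Surj`,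
`¬CM`), EVERY imaginary quadratic `K` with (Heeg) for `N_E` and `p = v v̄` split, the anticyclotomic
`ℤ_p`-extension, and every BDP `p`-adic `L`-function `L` in Castella's frame:
`ch_Λ(X_ac^{rel_v, str_v̄}(E/K_∞^ac)) · Λ^ur ⊆ (L)` — the EISENSTEIN-direction divisibility
`𝓛^BDP ∣ ch(X_ac)` ("the Selmer group is at least as large as the `p`-adic `L`-function predicts").
HOW (programme, see the module docstring): endoscopic ("Kudla") ideal of the `P_{2,1}`-semi-ordinary
family `χ ↦ θ(f_E, χ)` of unitary Kudla lifts on the Picard modular surface of `K`; Fourier–Jacobi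
primitivity mod `p` from Murase–Sugano Main Thm. I (primitive components = CM period × CM values of `f`
on the modular curve) and `μ(𝓛^BDP) = 0` (`prop422_exists_isBDPLFunction_mu_eq_zero`, Hsieh 2014
Thm. B); congruence module from the Rallis inner product formula (Murase–Sugano 2006); Urban/SU lattice
with the semi-ordinary flag at `v`, `v̄` ⟹ classes in the `(rel_v, str_v̄)` Selmer group over `K_∞^ac`.
NO Jacquet–Langlands transfer of `f`, no Steinberg/supercuspidal prime, no slope condition at `p`.
WHY IT MIGHT FAIL: (i) the Eisenstein-ideal method has never been run with a CUSPIDAL endoscopic lift in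
place of an Eisenstein series for a `GL₂`-motive over `K` — the identification "Kudla ideal ⊇ (𝓛^BDP)"
(Petersson norm of the semi-ordinarily stabilised lift `≐` BDP-range Rankin–Selberg values, integrally)
is not in print; (ii) semi-ordinary Hida theory with control for `H⁰` of the Picard surface is printed
only for `U(3,1)` (Wan 2020 §3) and Borel-ordinary `U(2,1)` (Hsieh 2014); (iii) congruences of `θ(f,χ)`
to OTHER endoscopic families `θ(g,χ)`, `g ≡ f (mod p)`, must be shown to cost only the (χ-constant)
congruence number of `f`. Size XL (open programme; every ingredient has a printed template).
[cite: doi:10.1112/S0010437X06002491, Murase–Sugano 2007, Main Thm. I (Thm. 7.5), Main Thm. III (Thm. 7.8)]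
[cite: Hsieh2014JAMS, Eisenstein congruence on `U(2,1)` and the CM main conjecture (template on the same Shimura surface)]
[cite: Wan2020ANT, Iwasawa main conjecture for Rankin–Selberg `p`-adic `L`-functions, §3 (semi-ordinary families on `U(3,1)`)]
[cite: GelbartRogawskiSoudry1997, Endoscopy, theta-liftings, and period integrals for the unitary group in three variables]
[cite: BurungaleCastellaSkinner2025, Prop. 4.2.2 (`μ = 0`, from Hsieh2014 Thm. B) and Thm. 1.2.4 (b) (shape of the statement)]
[cite: arXiv:2410.19992, A Λ-adic Kudla lift (2024) — `p`-adic families of Kudla lifts in the WEIGHT variable, no congruence application] -/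
theorem stub_bdpLowerHalf_kudla :
    ∀ (W : WeierstrassCurve ℚ) [W.IsElliptic] [W.IsGloballyMinimal] (p : ℕ) [Fact p.Prime],
      5 ≤ p → ClassX7 W p → ¬ W.HasCM → W.frobeniusTrace p = 0 → Surj W p →
      ∀ (ι : PadicAlgCl p ≃+* ℂ) (K : Type) [Field K] [NumberField K]
        (v vbar : HeightOneSpectrum (𝓞 K)) (κ : ZpExtension K p) (γ : absoluteGaloisGroup K)
        [Fact (κ.IsTopGenerator γ)] (N : ℕ) [NeZero N] (f : CuspForm (Gamma0 N) 2)
        (ΩK : ℂ) (Ωp : (unrIntegers p)ˣ) (L : UnrSeries p),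
        IsNewformOf W f → (N : ℤ) = W.conductorNorm ℤ → IsImaginaryQuadratic K →
        SatisfiesHeegnerHypothesis N K → ((Ideal.span {(p : ℤ)}).primesOver (𝓞 K)).ncard = 2 →
        ((p : ℕ) : 𝓞 K) ∈ v.asIdeal → ((p : ℕ) : 𝓞 K) ∈ vbar.asIdeal → vbar ≠ v →
        (∀ (w : InfinitePlace K) (k : 𝓞 K), k ∈ v.asIdeal ↔ ‖ι.symm (w.embedding (k : K))‖ < 1) →
        κ.IsAnticyclotomic →
        IsBDPLFunction ι v κ γ f ΩK ((Ωp : unrIntegers p) : ℂ_[p]) L →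
        ∀ j : ℤ_[p] →+* unrIntegers p,
          (∀ x : ℤ_[p], ((j x : unrIntegers p) : ℂ_[p]) = algebraMap ℚ_[p] ℂ_[p] (x : ℚ_[p])) →
          (AcSelmer.XAc.charIdeal (W.baseChange K) p κ vbar ∅ γ).map (PowerSeries.map j) ≤
            Ideal.span {L} := by
  sorry

/-- **K2 · from the one-variable BDP lower half to the anticyclotomic-LINE EQUALITY in the Greenberg
frame** (`stub_acLine_of_bdp`; printed modulo bookkeeping): for X7 data and any Heegner `p`-split frame,
IF the Eisenstein-direction containment `ch(X_ac^{rel,str})·Λ^ur ⊆ (L)` holds for every BDP datum on the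
frame's anticyclotomic extension `κ₂` (the conclusion of K1), THEN `G⁻ ≠ 0` and
`(ch(X_Gr)·Λ_K^ur)|_{T₁=0} = (G⁻)` — verbatim the conclusion of `Ac2CycSqueeze.stub_acLineEquality`.
HOW: the HEEGNER-direction divisibility `ch(X_ac) ∣ (𝓛^BDP)` with `X_ac` torsion is Castella–Wan 2024
Thm. 5.12 / BCS Thm. 4.2.1 (b)-shape at supersingular `p` (`p > 3` good, `Surj`, (Heeg), additive primes
allowed; Howard's Kolyvagin system of Heegner points + the BDP formula), so K1 upgrades it to EQUALITY
`ch(X_ac)·Λ^ur = (L)`; `G⁻ ≐ 𝓛^BDP` up to a unit of `Λ^ur` (the tree's fact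
`YanZhu2026.prop314_span_minus_eq_span_bdp_anyRoot`; `𝓛^BDP ≠ 0` by Cornut–Vatsal, and `μ = 0` by
`prop422_exists_isBDPLFunction_mu_eq_zero`); anticyclotomic control `X_Gr(E/K̃_∞)/T₁ ↠ X_ac` with
co-torsion kernel and no `T₁`-torsion in `ch` transports the equality to the line `T₁ = 0` (BSTW 2024
§3 / JSW 2017 §3.3 control; the same transport `ac2cyc`'s A2 performs). WHY IT MIGHT FAIL: the
`T₁`-torsion of `X_Gr₂` must be shown not to contribute to `(ch X_Gr)|_{T₁=0}` (pseudo-nullity input, as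
in every two-variable control argument); L-sized bookkeeping over printed theorems.
[cite: CastellaWan2023, §5.4 Thm. 5.12 (arXiv:1607.02019 p. 21)]
[cite: BurungaleCastellaSkinner2025, Thm. 4.2.1 (b) and Prop. 4.2.2 (arXiv:2405.00270v2 §4.2)]
[cite: YanZhu2024MainConjNonCM, Prop. 3.14 and Thm. 4.7 (arXiv:2412.20078v4)]
[cite: BurungaleSkinnerTianWan2024, §3 (control), arXiv:2409.01350] -/
theorem stub_acLine_of_bdp :
    ∀ (W : WeierstrassCurve ℚ) [W.IsElliptic] [W.IsGloballyMinimal] (p : ℕ) [Fact p.Prime],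
      5 ≤ p → ClassX7 W p → ¬ W.HasCM → W.frobeniusTrace p = 0 → Surj W p →
      ∀ (ι : PadicAlgCl p ≃+* ℂ) (K : Type) [Field K] [NumberField K]
        (v vbar : HeightOneSpectrum (𝓞 K)) (κ₁ κ₂ : ZpExtension K p) (γ₁ γ₂ : absoluteGaloisGroup K)
        [Fact (ZpExtension.IsTopGeneratorPair κ₁ κ₂ γ₁ γ₂)] (N : ℕ) [NeZero N]
        (f : CuspForm (Gamma0 N) 2) [NeZero (NumberField.discr K).natAbs]
        (Ω δ : ℂ) (Ωp : (unrIntegers p)ˣ) (LK G : PowerSeries (PowerSeries (PadicComplexInt p))),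
        (IsNewformOf W f ∧ (N : ℤ) = W.conductorNorm ℤ ∧ IsImaginaryQuadratic K ∧
          SatisfiesHeegnerHypothesis N K ∧ ((Ideal.span {(p : ℤ)}).primesOver (𝓞 K)).ncard = 2 ∧
          ((p : ℕ) : 𝓞 K) ∈ v.asIdeal ∧ ((p : ℕ) : 𝓞 K) ∈ vbar.asIdeal ∧ vbar ≠ v ∧
          (∀ (w : InfinitePlace K) (k : 𝓞 K), k ∈ v.asIdeal ↔ ‖ι.symm (w.embedding (k : K))‖ < 1) ∧
          κ₁.IsCyclotomic ∧ κ₂.IsAnticyclotomic) →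
        (Ω ≠ 0 ∧ (δ ^ 2 = (NumberField.discr K : ℂ) ∨ δ ^ 2 = -(NumberField.discr K : ℂ)) ∧
          IsKatzMeasure₂ ι v vbar ∅ κ₁ κ₂ γ₁⁻¹ γ₂⁻¹ 1 Ω δ ((Ωp : unrIntegers p) : ℂ_[p]) LK ∧
          IsGreenbergLFunctionAnyRoot₂ ι v vbar κ₁ κ₂ γ₁⁻¹ γ₂⁻¹ f (NumberField.discr K).natAbs
            (NumberField.classNumber K) LK G) →
        (∀ (γ : absoluteGaloisGroup K) [Fact (κ₂.IsTopGenerator γ)] (ΩK : ℂ) (Ωp' : (unrIntegers p)ˣ)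
            (L : UnrSeries p), IsBDPLFunction ι v κ₂ γ f ΩK ((Ωp' : unrIntegers p) : ℂ_[p]) L →
            ∀ j : ℤ_[p] →+* unrIntegers p,
              (∀ x : ℤ_[p], ((j x : unrIntegers p) : ℂ_[p]) = algebraMap ℚ_[p] ℂ_[p] (x : ℚ_[p])) →
              (AcSelmer.XAc.charIdeal (W.baseChange K) p κ₂ vbar ∅ γ).map (PowerSeries.map j) ≤
                Ideal.span {L}) →
        (minus G ≠ 0 ∧
          ∀ J : ℤ_[p] →+* PadicComplexInt p,
            (∀ x : ℤ_[p], ((J x : PadicComplexInt p) : ℂ_[p]) = ((x : ℚ_[p]) : ℂ_[p])) →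
            ((WeierstrassCurve.XGr₂.charIdeal (W.baseChange K) p κ₁ κ₂ vbar γ₁ γ₂).map (toUnr₂ p J)).map
                (PowerSeries.constantCoeff :
                  PowerSeries (PowerSeries (PadicComplexInt p)) →+* PowerSeries (PadicComplexInt p)) =
              Ideal.span {minus G}) := by
  sorry

/-- **A1 · frame supply** — VERBATIM `Ac2CycSqueeze.stub_frameSupply` (shared statement): every X7 pair
admits Heegner `p`-split data and a Greenberg value frame. [cite: BurungaleSkinnerTianWan2024, §1.2.1 and Prop. 9.18 (arXiv:2409.01350)]
[cite: YanZhu2024MainConjNonCM, Thm. 3.9, Thm. 3.10, Def. 3.11 (arXiv:2412.20078v4)] -/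
theorem stub_frameSupply :
    ∀ (W : WeierstrassCurve ℚ) [W.IsElliptic] [W.IsGloballyMinimal] (p : ℕ) [Fact p.Prime],
      5 ≤ p → ClassX7 W p → ¬ W.HasCM → W.frobeniusTrace p = 0 → Surj W p →
      ∃ (ι : PadicAlgCl p ≃+* ℂ) (K : Type) (_ : Field K) (_ : NumberField K)
        (v vbar : HeightOneSpectrum (𝓞 K)) (κ₁ κ₂ : ZpExtension K p) (γ₁ γ₂ : absoluteGaloisGroup K)
        (_ : Fact (ZpExtension.IsTopGeneratorPair κ₁ κ₂ γ₁ γ₂)) (N : ℕ) (_ : NeZero N)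
        (f : CuspForm (Gamma0 N) 2) (_ : NeZero (NumberField.discr K).natAbs)
        (Ω δ : ℂ) (Ωp : (unrIntegers p)ˣ) (LK G : PowerSeries (PowerSeries (PadicComplexInt p))),
        (IsNewformOf W f ∧ (N : ℤ) = W.conductorNorm ℤ ∧ IsImaginaryQuadratic K ∧
          SatisfiesHeegnerHypothesis N K ∧ ((Ideal.span {(p : ℤ)}).primesOver (𝓞 K)).ncard = 2 ∧
          ((p : ℕ) : 𝓞 K) ∈ v.asIdeal ∧ ((p : ℕ) : 𝓞 K) ∈ vbar.asIdeal ∧ vbar ≠ v ∧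
          (∀ (w : InfinitePlace K) (k : 𝓞 K), k ∈ v.asIdeal ↔ ‖ι.symm (w.embedding (k : K))‖ < 1) ∧
          κ₁.IsCyclotomic ∧ κ₂.IsAnticyclotomic) ∧
        (Ω ≠ 0 ∧ (δ ^ 2 = (NumberField.discr K : ℂ) ∨ δ ^ 2 = -(NumberField.discr K : ℂ)) ∧
          IsKatzMeasure₂ ι v vbar ∅ κ₁ κ₂ γ₁⁻¹ γ₂⁻¹ 1 Ω δ ((Ωp : unrIntegers p) : ℂ_[p]) LK ∧
          IsGreenbergLFunctionAnyRoot₂ ι v vbar κ₁ κ₂ γ₁⁻¹ γ₂⁻¹ f (NumberField.discr K).natAbs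
            (NumberField.classNumber K) LK G) := by
  sorry

/-- **A3 · two-variable Kato side** — VERBATIM `Ac2CycSqueeze.stub_twoVariable_katoSide` (shared; the
OTHER open stub of this line, inherited): `X_Gr(E/K̃_∞)` is `Λ_K`-torsion and `(L_p^Gr) ⊆ ch(X_Gr)·Λ_K^ur`.
No Euler system of the right shape is in print at `χ = 𝟙`, `a_p = 0` (BCS25 fn. 3).
[cite: BurungaleCastellaSkinner2025, statement 4.1.2 and fn. 3 (arXiv:2405.00270v2 pp. 5, 8)]
[cite: arXiv:1605.05310, Büyükboduk–Lei, Thm. 1.3 and Thm. 3.2.1 (pp. 3, 18)] -/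
theorem stub_twoVariable_katoSide :
    ∀ (W : WeierstrassCurve ℚ) [W.IsElliptic] [W.IsGloballyMinimal] (p : ℕ) [Fact p.Prime],
      5 ≤ p → ClassX7 W p → ¬ W.HasCM → W.frobeniusTrace p = 0 → Surj W p →
      ∀ (ι : PadicAlgCl p ≃+* ℂ) (K : Type) [Field K] [NumberField K]
        (v vbar : HeightOneSpectrum (𝓞 K)) (κ₁ κ₂ : ZpExtension K p) (γ₁ γ₂ : absoluteGaloisGroup K)
        [Fact (ZpExtension.IsTopGeneratorPair κ₁ κ₂ γ₁ γ₂)] (N : ℕ) [NeZero N]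
        (f : CuspForm (Gamma0 N) 2) [NeZero (NumberField.discr K).natAbs]
        (Ω δ : ℂ) (Ωp : (unrIntegers p)ˣ) (LK G : PowerSeries (PowerSeries (PadicComplexInt p))),
        (IsNewformOf W f ∧ (N : ℤ) = W.conductorNorm ℤ ∧ IsImaginaryQuadratic K ∧
          SatisfiesHeegnerHypothesis N K ∧ ((Ideal.span {(p : ℤ)}).primesOver (𝓞 K)).ncard = 2 ∧
          ((p : ℕ) : 𝓞 K) ∈ v.asIdeal ∧ ((p : ℕ) : 𝓞 K) ∈ vbar.asIdeal ∧ vbar ≠ v ∧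
          (∀ (w : InfinitePlace K) (k : 𝓞 K), k ∈ v.asIdeal ↔ ‖ι.symm (w.embedding (k : K))‖ < 1) ∧
          κ₁.IsCyclotomic ∧ κ₂.IsAnticyclotomic) →
        (Ω ≠ 0 ∧ (δ ^ 2 = (NumberField.discr K : ℂ) ∨ δ ^ 2 = -(NumberField.discr K : ℂ)) ∧
          IsKatzMeasure₂ ι v vbar ∅ κ₁ κ₂ γ₁⁻¹ γ₂⁻¹ 1 Ω δ ((Ωp : unrIntegers p) : ℂ_[p]) LK ∧
          IsGreenbergLFunctionAnyRoot₂ ι v vbar κ₁ κ₂ γ₁⁻¹ γ₂⁻¹ f (NumberField.discr K).natAbs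
            (NumberField.classNumber K) LK G) →
        (Module.IsTorsion (IwasawaAlgebra₂ p) ((W.baseChange K).XGr₂ p κ₁ κ₂ vbar γ₁ γ₂) ∧
          ∀ J : ℤ_[p] →+* PadicComplexInt p,
            (∀ x : ℤ_[p], ((J x : PadicComplexInt p) : ℂ_[p]) = ((x : ℚ_[p]) : ℂ_[p])) →
            Ideal.span {G} ≤
              (WeierstrassCurve.XGr₂.charIdeal (W.baseChange K) p κ₁ κ₂ vbar γ₁ γ₂).map (toUnr₂ p J)) := by
  sorry

/-- **A4 · principality** — VERBATIM `Ac2CycSqueeze.stub_charIdeal_isPrincipal` (shared): `Λ₂` is a UFD,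
so `ch(X_Gr)` is principal. [cite: Washington1997, §13.2] [cite: BurungaleCastellaSkinner2025, Thm. 1.4.1 (p. 4)] -/
theorem stub_charIdeal_isPrincipal :
    ∀ {p : ℕ} [Fact p.Prime] (W : WeierstrassCurve ℚ) [W.IsElliptic] [W.IsGloballyMinimal] (K : Type)
      [Field K] [NumberField K] (vbar : HeightOneSpectrum (𝓞 K)) (κ₁ κ₂ : ZpExtension K p)
      (γ₁ γ₂ : absoluteGaloisGroup K) [Fact (ZpExtension.IsTopGeneratorPair κ₁ κ₂ γ₁ γ₂)],
      (WeierstrassCurve.XGr₂.charIdeal (W.baseChange K) p κ₁ κ₂ vbar γ₁ γ₂).IsPrincipal := by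
  sorry

/-- **A5 · descent to the cyclotomic line and the supersingular frame switch** — VERBATIM
`Ac2CycSqueeze.stub_descent` (shared): the two-variable Greenberg main conjecture at the frame yields
Kobayashi's LOWER divisibility for some sign (CCSS Thm. 3.7/§3.3 on the cyclotomic line; Kato–Kobayashi
bounds the twist factor). [cite: CastellaCiperianiSkinnerSprung2018, Thm. 3.6, Thm. 3.7, §3.3 (arXiv:1804.10993 pp. 13–15)]
[cite: YanZhu2024MainConjNonCM, Cor. 5.4 (arXiv:2412.20078v4 l.1166–1184)] [cite: Kobayashi2003, Thm. 1.3, Thm. 4.1] -/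
theorem stub_descent :
    ∀ (W : WeierstrassCurve ℚ) [W.IsElliptic] [W.IsGloballyMinimal] (p : ℕ) [Fact p.Prime],
      5 ≤ p → ClassX7 W p → ¬ W.HasCM → W.frobeniusTrace p = 0 → Surj W p →
      ∀ (ι : PadicAlgCl p ≃+* ℂ) (K : Type) [Field K] [NumberField K]
        (v vbar : HeightOneSpectrum (𝓞 K)) (κ₁ κ₂ : ZpExtension K p) (γ₁ γ₂ : absoluteGaloisGroup K)
        [Fact (ZpExtension.IsTopGeneratorPair κ₁ κ₂ γ₁ γ₂)] (N : ℕ) [NeZero N]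
        (f : CuspForm (Gamma0 N) 2) [NeZero (NumberField.discr K).natAbs],
        (IsNewformOf W f ∧ (N : ℤ) = W.conductorNorm ℤ ∧ IsImaginaryQuadratic K ∧
          SatisfiesHeegnerHypothesis N K ∧ ((Ideal.span {(p : ℤ)}).primesOver (𝓞 K)).ncard = 2 ∧
          ((p : ℕ) : 𝓞 K) ∈ v.asIdeal ∧ ((p : ℕ) : 𝓞 K) ∈ vbar.asIdeal ∧ vbar ≠ v ∧
          (∀ (w : InfinitePlace K) (k : 𝓞 K), k ∈ v.asIdeal ↔ ‖ι.symm (w.embedding (k : K))‖ < 1) ∧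
          κ₁.IsCyclotomic ∧ κ₂.IsAnticyclotomic) →
        GreenbergTwoVariableMainConjectureAnyRootAt ι W K v vbar κ₁ κ₂ γ₁ γ₂ f →
        ∃ ε : ℤˣ, KobayashiLowerDivisibility W p ε := by
  sorry

/-- **A6 · the prime 3** — VERBATIM `Ac2CycSqueeze.stub_three` = `KuriharaRigidity.stub_three` (one
shared statement across the crux's lines). [cite: Kato2004, Thm. 17.4 (pp. 68–69)] [cite: Wuthrich2014, Thm. 4 and §9] -/
theorem stub_three :
    ∀ (W : WeierstrassCurve ℚ) [W.IsElliptic] [W.IsGloballyMinimal] (p : ℕ) [Fact p.Prime],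
      p = 3 → ClassX7 W p → ¬ W.HasCM → W.frobeniusTrace p = 0 → Surj W p →
      ∃ ε : ℤˣ, KobayashiLowerDivisibility W p ε := by
  sorry

/-! ## Compositions (PROVED) -/

/-- **K1 + K2 ⟹ the anticyclotomic-line equality** (the conclusion of `Ac2CycSqueeze.stub_acLineEquality`)
at any Heegner `p`-split frame of an X7 pair — the Kudla engine REPLACES Kolyvagin's conjecture. -/
theorem acLineEquality_of_kudla (W : WeierstrassCurve ℚ) [W.IsElliptic] [W.IsGloballyMinimal] (p : ℕ)
    [Fact p.Prime] (hp : 5 ≤ p) (hX7 : ClassX7 W p) (hCM : ¬ W.HasCM) (hap : W.frobeniusTrace p = 0)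
    (hS : Surj W p) (ι : PadicAlgCl p ≃+* ℂ) (K : Type) [Field K] [NumberField K]
    (v vbar : HeightOneSpectrum (𝓞 K)) (κ₁ κ₂ : ZpExtension K p) (γ₁ γ₂ : absoluteGaloisGroup K)
    [Fact (ZpExtension.IsTopGeneratorPair κ₁ κ₂ γ₁ γ₂)] (N : ℕ) [NeZero N]
    (f : CuspForm (Gamma0 N) 2) [NeZero (NumberField.discr K).natAbs]
    (Ω δ : ℂ) (Ωp : (unrIntegers p)ˣ) (LK G : PowerSeries (PowerSeries (PadicComplexInt p)))
    (hData : IsNewformOf W f ∧ (N : ℤ) = W.conductorNorm ℤ ∧ IsImaginaryQuadratic K ∧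
          SatisfiesHeegnerHypothesis N K ∧ ((Ideal.span {(p : ℤ)}).primesOver (𝓞 K)).ncard = 2 ∧
          ((p : ℕ) : 𝓞 K) ∈ v.asIdeal ∧ ((p : ℕ) : 𝓞 K) ∈ vbar.asIdeal ∧ vbar ≠ v ∧
          (∀ (w : InfinitePlace K) (k : 𝓞 K), k ∈ v.asIdeal ↔ ‖ι.symm (w.embedding (k : K))‖ < 1) ∧
          κ₁.IsCyclotomic ∧ κ₂.IsAnticyclotomic)
    (hFrame : Ω ≠ 0 ∧ (δ ^ 2 = (NumberField.discr K : ℂ) ∨ δ ^ 2 = -(NumberField.discr K : ℂ)) ∧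
          IsKatzMeasure₂ ι v vbar ∅ κ₁ κ₂ γ₁⁻¹ γ₂⁻¹ 1 Ω δ ((Ωp : unrIntegers p) : ℂ_[p]) LK ∧
          IsGreenbergLFunctionAnyRoot₂ ι v vbar κ₁ κ₂ γ₁⁻¹ γ₂⁻¹ f (NumberField.discr K).natAbs
            (NumberField.classNumber K) LK G) :
    minus G ≠ 0 ∧
      ∀ J : ℤ_[p] →+* PadicComplexInt p,
        (∀ x : ℤ_[p], ((J x : PadicComplexInt p) : ℂ_[p]) = ((x : ℚ_[p]) : ℂ_[p])) →
        ((WeierstrassCurve.XGr₂.charIdeal (W.baseChange K) p κ₁ κ₂ vbar γ₁ γ₂).map (toUnr₂ p J)).map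
            (PowerSeries.constantCoeff :
              PowerSeries (PowerSeries (PadicComplexInt p)) →+* PowerSeries (PadicComplexInt p)) =
          Ideal.span {minus G} := by
  have hD := hData
  obtain ⟨h1, h2, h3, h4, h5, h6, h7, h8, h9, _, h11⟩ := hD
  refine stub_acLine_of_bdp W p hp hX7 hCM hap hS ι K v vbar κ₁ κ₂ γ₁ γ₂ N f Ω δ Ωp LK G hData hFrame ?_
  intro γ _ ΩK Ωp' L hL j hj
  exact stub_bdpLowerHalf_kudla W p hp hX7 hCM hap hS ι K v vbar κ₂ γ N f ΩK Ωp' L h1 h2 h3 h4 h5 h6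
    h7 h8 h9 h11 hL j hj

/-- **K1 + K2 + A3 + A4 ⟹ the two-variable main conjecture at the frame** (the squeeze, verbatim
`Ac2CycSqueeze.twoVariableMC_of_stubs` with A2 replaced). [cite: BurungaleCastellaSkinner2025, statement 4.1.2] -/
theorem twoVariableMC_of_stubs {p : ℕ} [Fact p.Prime] (ι : PadicAlgCl p ≃+* ℂ)
    (W : WeierstrassCurve ℚ) [W.IsElliptic] [W.IsGloballyMinimal] (K : Type) [Field K] [NumberField K]
    (v vbar : HeightOneSpectrum (𝓞 K)) (κ₁ κ₂ : ZpExtension K p) (γ₁ γ₂ : absoluteGaloisGroup K)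
    [Fact (ZpExtension.IsTopGeneratorPair κ₁ κ₂ γ₁ γ₂)] {N : ℕ} [NeZero N]
    (f : CuspForm (Gamma0 N) 2) [NeZero (NumberField.discr K).natAbs]
    (Ω δ : ℂ) (Ωp : (unrIntegers p)ˣ) (LK G : PowerSeries (PowerSeries (PadicComplexInt p)))
    (hframe : (Ω ≠ 0 ∧ (δ ^ 2 = (NumberField.discr K : ℂ) ∨ δ ^ 2 = -(NumberField.discr K : ℂ)) ∧
          IsKatzMeasure₂ ι v vbar ∅ κ₁ κ₂ γ₁⁻¹ γ₂⁻¹ 1 Ω δ ((Ωp : unrIntegers p) : ℂ_[p]) LK ∧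
          IsGreenbergLFunctionAnyRoot₂ ι v vbar κ₁ κ₂ γ₁⁻¹ γ₂⁻¹ f (NumberField.discr K).natAbs
            (NumberField.classNumber K) LK G))
    (hprinc : (WeierstrassCurve.XGr₂.charIdeal (W.baseChange K) p κ₁ κ₂ vbar γ₁ γ₂).IsPrincipal)
    (hKato : (Module.IsTorsion (IwasawaAlgebra₂ p) ((W.baseChange K).XGr₂ p κ₁ κ₂ vbar γ₁ γ₂) ∧
          ∀ J : ℤ_[p] →+* PadicComplexInt p,
            (∀ x : ℤ_[p], ((J x : PadicComplexInt p) : ℂ_[p]) = ((x : ℚ_[p]) : ℂ_[p])) →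
            Ideal.span {G} ≤
              (WeierstrassCurve.XGr₂.charIdeal (W.baseChange K) p κ₁ κ₂ vbar γ₁ γ₂).map (toUnr₂ p J)))
    (hAc : (minus G ≠ 0 ∧
          ∀ J : ℤ_[p] →+* PadicComplexInt p,
            (∀ x : ℤ_[p], ((J x : PadicComplexInt p) : ℂ_[p]) = ((x : ℚ_[p]) : ℂ_[p])) →
            ((WeierstrassCurve.XGr₂.charIdeal (W.baseChange K) p κ₁ κ₂ vbar γ₁ γ₂).map (toUnr₂ p J)).map
                (PowerSeries.constantCoeff :
                  PowerSeries (PowerSeries (PadicComplexInt p)) →+* PowerSeries (PadicComplexInt p)) =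
              Ideal.span {minus G})) :
    GreenbergTwoVariableMainConjectureAnyRootAt ι W K v vbar κ₁ κ₂ γ₁ γ₂ f :=
  ⟨Ω, δ, Ωp, LK, G, hframe.1, hframe.2.1, hframe.2.2.1, hframe.2.2.2, hKato.1,
    charIdeal_map_eq_span_of_katoSide_of_acLine W K vbar κ₁ κ₂ γ₁ γ₂ G hprinc hKato hAc⟩

/-- **The `p ≥ 5` lower half from the stubs K1, K2, A1, A3, A4, A5.** -/
theorem lowerHalf_five_le (W : WeierstrassCurve ℚ) [W.IsElliptic] [W.IsGloballyMinimal] (p : ℕ)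
    [Fact p.Prime] (hp : 5 ≤ p) (hX7 : ClassX7 W p) (hCM : ¬ W.HasCM) (hap : W.frobeniusTrace p = 0)
    (hS : Surj W p) : ∃ ε : ℤˣ, KobayashiLowerDivisibility W p ε := by
  obtain ⟨ι, K, iF, iNF, v, vbar, κ₁, κ₂, γ₁, γ₂, iγ, N, iN, f, iD, Ω, δ, Ωp, LK, G, hData, hFrame⟩ :=
    stub_frameSupply W p hp hX7 hCM hap hS
  have hAc := acLineEquality_of_kudla W p hp hX7 hCM hap hS ι K v vbar κ₁ κ₂ γ₁ γ₂ N f Ω δ Ωp LK G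
    hData hFrame
  have hKato :=
    stub_twoVariable_katoSide W p hp hX7 hCM hap hS ι K v vbar κ₁ κ₂ γ₁ γ₂ N f Ω δ Ωp LK G hData hFrame
  have hMC : GreenbergTwoVariableMainConjectureAnyRootAt ι W K v vbar κ₁ κ₂ γ₁ γ₂ f :=
    twoVariableMC_of_stubs ι W K v vbar κ₁ κ₂ γ₁ γ₂ f Ω δ Ωp LK G hFrame
      (stub_charIdeal_isPrincipal W K vbar κ₁ κ₂ γ₁ γ₂) hKato hAc
  exact stub_descent W p hp hX7 hCM hap hS ι K v vbar κ₁ κ₂ γ₁ γ₂ N f hData hMC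

/-- A good supersingular odd prime with `a_p = 0` is `3` or `≥ 5`. -/
theorem three_or_five_le (p : ℕ) [hp : Fact p.Prime] (hp2 : p ≠ 2) : p = 3 ∨ 5 ≤ p := by
  have hpP : p.Prime := hp.out
  by_cases hp5 : 5 ≤ p
  · exact Or.inr hp5
  · left
    have h2le := hpP.two_le
    interval_cases p
    · exact absurd rfl hp2
    · rfl
    · exact absurd hpP (by decide)

/-- **THE CRUX BY NAME from the seven stubs**: `Theses.SignedLowerHalves.KobayashiLowerHalfLargeImage`. -/
theorem KobayashiLowerHalfLargeImage_of :
    Summit.BirchSwinnertonDyer.BirchSwinnertonDyer.Theses.SignedLowerHalves.KobayashiLowerHalfLargeImage := by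
  intro W _ _ p _ h2 hX7 hCM hap hS
  rcases three_or_five_le p h2 with h3 | h5
  · exact stub_three W p h3 hX7 hCM hap hS
  · exact lowerHalf_five_le W p h5 hX7 hCM hap hS

end KudlaCongruence

end Summit.BirchSwinnertonDyer.BirchSwinnertonDyer.Cruxes.KobayashiLowerHalfLargeImage
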